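import Literature.NumberTheory.LFunctions.DedekindZetaDiscriminantBound
import HarnessLib

/-!
# The Stark–Odlyzko root-discriminant bounds `|d_K|^{1/n} ≳ (4πe^γ)^{r₁/n}(2πe^γ)^{2r₂/n}`,
# explicit in the degree

Topic `Summits/QuantumAdvantage/QuantumAdvantage/Theorems`, helper file for the crux
`DegreeOnePrimesEscape` (stmt-QuantumAdvantage-11543, closed) of route `LinnikCubicClassGroups`;
cell B2b-1 (linnik-cubic), PART A. HONEST FRAMING: the value of this file is a THEOREM (explicit,
kernel-checked discriminant bounds) — NOT summit progress.

The tree's `Literature.NumberTheory.LFunctions.NumberField.log_absdiscr_ge_linear` (Stark's analytic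
bound in tangent-line form, [Bordelles2020ArithmeticTales, Prop. 7.32]) gives, for every `h > 0`,
`log|d_K| ≥ r₁(log 4π + γ − (π²/4)h) + 2r₂(log 2π + γ − (π²/6)h) − 2/h − 2/(1+h)`.
Optimising `h = 2/√(π²n/2)` WITHOUT discarding the real places (Bordellès' Cor. 7.9 absorbs them
into `(2π)^n`) yields the classical Stark–Odlyzko shape with an explicit, degree-uniform error:

* `log_absdiscr_ge_signature` — **`log|d_K| ≥ r₁ log(4πe^γ) + 2r₂ log(2πe^γ) − 2√(π²n/2) − 2`** for
  every number field `K` of degree `n = r₁ + 2r₂` (`2√(π²n/2) = π√(2n)`);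
* `absdiscr_ge_signature` — the same exponentiated:
  `|d_K| ≥ (4πe^γ)^{r₁}(2πe^γ)^{2r₂} e^{−2√(π²n/2) − 2}`;
* `lt_four_pi_exp_eulerMascheroni`, `lt_two_pi_exp_eulerMascheroni` — `22.38 < 4πe^γ`,
  `11.19 < 2πe^γ`; `absdiscr_ge_numeric(_totallyReal)` — `|d_K| ≥ 11.19^n e^{−π√(2n)−2}` for every
  `K`, `|d_K| ≥ 22.38^n e^{−π√(2n)−2}` for totally real `K`;
* `exists_pow_le_absdiscr_of_lt` / `…_totallyReal_of_lt` — **asymptotic root-discriminant bounds**: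
  for every `θ < 2πe^γ` (resp. `θ < 4πe^γ`) there is `N` with `θ^n ≤ |d_K|` for every number field
  (resp. totally real number field) of degree `n ≥ N`;
* `finrank_le_log_absdiscr` — **the degree is `O(log|d_K|)`**: `n ≤ (log|d_K| + 8)/log 2π` for every
  number field (from [Bordelles2020ArithmeticTales, Cor. 7.9]; Mathlib's Minkowski bound
  `NumberField.abs_discr_ge` gives the slope `1/log(3π/4) ≈ 1.17` instead of `1/log 2π ≈ 0.54`).

These are the constants `(4πe^γ, 2πe^γ) ≈ (22.38, 11.19)` of Stark's method with the prime and zero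
sums discarded (Odlyzko's refinements `(60.8, 22.4)` and the GRH values `(215.3, 44.7)` keep them).

## References

* O. Bordellès, *Arithmetic Tales. Advanced Edition*, Universitext (2020), Prop. 7.32, Cor. 7.9.
  [Bordelles2020ArithmeticTales]
* H. M. Stark, *The analytic theory of algebraic numbers*, Bull. AMS 81 (1975) 961–972. [Stark1975]
-/

noncomputable section

open scoped NumberField
open Complex Filter Topology Set NumberField NumberField.InfinitePlace

namespace Summit.QuantumAdvantage.QuantumAdvantage.Theorems.DegreeOnePrimesEscape

namespace Discriminant

open Literature.NumberTheory.LFunctions Literature.NumberTheory.LFunctions.NumberField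

/-! ### The signature form of Stark's bound -/

/-- **Stark–Odlyzko, explicit in the degree**: for every number field `K` of degree `n` and
signature `(r₁, r₂)`, `log|d_K| ≥ r₁(log 4π + γ) + 2r₂(log 2π + γ) − 2√(π²n/2) − 2`
(tangent-line form of Stark's bound at `h = 2/√(π²n/2)`, slopes `π²/6 ≤ π²/4` per unit of degree).
[cite: Bordelles2020ArithmeticTales, Prop. 7.32] -/
theorem log_absdiscr_ge_signature (K : Type*) [Field K] [NumberField K] :
    (nrRealPlaces K : ℝ) * (Real.log (4 * Real.pi) + Real.eulerMascheroniConstant) +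
        2 * (nrComplexPlaces K : ℝ) * (Real.log (2 * Real.pi) + Real.eulerMascheroniConstant) -
        2 * Real.sqrt (Real.pi ^ 2 * Module.finrank ℚ K / 2) - 2 ≤
      Real.log ((discr K).natAbs : ℝ) := by
  set n : ℕ := Module.finrank ℚ K with hn_def
  have hn1 : (1 : ℝ) ≤ n := by
    rw [hn_def]; exact_mod_cast Module.finrank_pos
  set s : ℝ := Real.sqrt (Real.pi ^ 2 * n / 2) with hs_def
  have hπ0 := Real.pi_pos
  have hs2 : s ^ 2 = Real.pi ^ 2 * n / 2 := by rw [hs_def, Real.sq_sqrt (by positivity)]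
  have hs0 : 0 < s := by rw [hs_def]; exact Real.sqrt_pos.2 (by positivity)
  have hh : 0 < 2 / s := by positivity
  have hmain := log_absdiscr_ge_linear K hh
  have hrank : (nrRealPlaces K : ℝ) + 2 * nrComplexPlaces K = n := by
    rw [hn_def]; exact_mod_cast card_add_two_mul_card_eq_rank K
  have hr1 : (0 : ℝ) ≤ nrRealPlaces K := Nat.cast_nonneg _
  have hr2 : (0 : ℝ) ≤ nrComplexPlaces K := Nat.cast_nonneg _
  have ht1 : Real.pi ^ 2 / 4 * (2 / s) * n = s := by
    calc Real.pi ^ 2 / 4 * (2 / s) * n = (Real.pi ^ 2 * n / 2) / s := by ring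
      _ = s ^ 2 / s := by rw [← hs2]
      _ = s := by rw [sq, mul_div_cancel_right₀ _ hs0.ne']
  have ht2 : 2 / (2 / s) = s := by field_simp
  have ht3 : 2 / (1 + 2 / s) ≤ 2 := by
    rw [div_le_iff₀ (by positivity)]; nlinarith
  rw [ht2] at hmain
  set A4 : ℝ := Real.log (4 * Real.pi) + Real.eulerMascheroniConstant with hA4
  set A2 : ℝ := Real.log (2 * Real.pi) + Real.eulerMascheroniConstant with hA2
  set c : ℝ := Real.pi ^ 2 / 4 * (2 / s) with hc
  set c' : ℝ := Real.pi ^ 2 / 6 * (2 / s) with hc'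
  have hcc' : c' ≤ c := by
    simp only [hc, hc']
    have : 0 ≤ 2 / s := hh.le
    nlinarith [sq_nonneg Real.pi]
  have e2 : 2 * (nrComplexPlaces K : ℝ) * c' ≤ 2 * (nrComplexPlaces K : ℝ) * c :=
    mul_le_mul_of_nonneg_left hcc' (by positivity)
  have hnc : (n : ℝ) * c = s := by rw [← ht1]; ring
  have key : (nrRealPlaces K : ℝ) * c + 2 * (nrComplexPlaces K : ℝ) * c = (n : ℝ) * c := by
    rw [← hrank]; ring
  linarith [hmain, e2, key, hnc, ht3]

/-- **Exponentiated form**: `|d_K| ≥ (4πe^γ)^{r₁}(2πe^γ)^{2r₂}·e^{−2√(π²n/2) − 2}` for every number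
field `K` of degree `n`. [cite: Bordelles2020ArithmeticTales, Prop. 7.32] -/
theorem absdiscr_ge_signature (K : Type*) [Field K] [NumberField K] :
    (4 * Real.pi * Real.exp Real.eulerMascheroniConstant) ^ nrRealPlaces K *
        (2 * Real.pi * Real.exp Real.eulerMascheroniConstant) ^ (2 * nrComplexPlaces K) *
        Real.exp (-(2 * Real.sqrt (Real.pi ^ 2 * Module.finrank ℚ K / 2) + 2)) ≤
      ((discr K).natAbs : ℝ) := by
  have h := log_absdiscr_ge_signature K
  have hπ0 := Real.pi_pos
  have hd : 0 < ((discr K).natAbs : ℝ) := by exact_mod_cast Int.natAbs_pos.mpr (discr_ne_zero K)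
  have e4 : 4 * Real.pi * Real.exp Real.eulerMascheroniConstant =
      Real.exp (Real.log (4 * Real.pi) + Real.eulerMascheroniConstant) := by
    rw [Real.exp_add, Real.exp_log (by positivity)]
  have e2 : 2 * Real.pi * Real.exp Real.eulerMascheroniConstant =
      Real.exp (Real.log (2 * Real.pi) + Real.eulerMascheroniConstant) := by
    rw [Real.exp_add, Real.exp_log (by positivity)]
  rw [e4, e2, ← Real.exp_nat_mul, ← Real.exp_nat_mul, ← Real.exp_add, ← Real.exp_add,
    ← Real.exp_log hd, Real.exp_le_exp]
  push_cast
  linarith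

/-! ### Numerics: `4πe^γ > 22.38`, `2πe^γ > 11.19` -/

/-- `e^γ > 1.78104` (`γ > 0.5772`, eight terms of the exponential series). [folklore] -/
theorem exp_eulerMascheroni_gt : (1.78104 : ℝ) < Real.exp Real.eulerMascheroniConstant := by
  have hγ := Literature.Analysis.SpecialFunctions.Real.eulerMascheroniConstant_gt_d8
  have h1 : Real.exp (0.5772 : ℝ) ≤ Real.exp Real.eulerMascheroniConstant :=
    Real.exp_le_exp.2 (by linarith)
  have h2 := Real.sum_le_exp_of_nonneg (show (0 : ℝ) ≤ 0.5772 by norm_num) 8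
  have h3 : (1.78104 : ℝ) < ∑ i ∈ Finset.range 8, (0.5772 : ℝ) ^ i / (i.factorial : ℝ) := by
    simp only [Finset.sum_range_succ, Finset.sum_range_zero, Nat.factorial]
    norm_num
  linarith

/-- **`4πe^γ > 22.38`**. [folklore] -/
theorem lt_four_pi_exp_eulerMascheroni :
    (22.38 : ℝ) < 4 * Real.pi * Real.exp Real.eulerMascheroniConstant := by
  have h := exp_eulerMascheroni_gt
  have hπ := Real.pi_gt_d6
  nlinarith

/-- **`2πe^γ > 11.19`**. [folklore] -/
theorem lt_two_pi_exp_eulerMascheroni :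
    (11.19 : ℝ) < 2 * Real.pi * Real.exp Real.eulerMascheroniConstant := by
  have h := exp_eulerMascheroni_gt
  have hπ := Real.pi_gt_d6
  nlinarith

/-- **Numeric form**: `|d_K| ≥ 11.19^n · e^{−2√(π²n/2) − 2}` for every number field `K` of degree `n`.
[cite: Bordelles2020ArithmeticTales, Prop. 7.32] -/
theorem absdiscr_ge_numeric (K : Type*) [Field K] [NumberField K] :
    (11.19 : ℝ) ^ Module.finrank ℚ K *
        Real.exp (-(2 * Real.sqrt (Real.pi ^ 2 * Module.finrank ℚ K / 2) + 2)) ≤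
      ((discr K).natAbs : ℝ) := by
  have h := absdiscr_ge_signature K
  have h4 := lt_four_pi_exp_eulerMascheroni
  have h2 := lt_two_pi_exp_eulerMascheroni
  have hrank : nrRealPlaces K + 2 * nrComplexPlaces K = Module.finrank ℚ K :=
    card_add_two_mul_card_eq_rank K
  refine le_trans ?_ h
  gcongr ?_ * _
  calc (11.19 : ℝ) ^ Module.finrank ℚ K
      = 11.19 ^ nrRealPlaces K * 11.19 ^ (2 * nrComplexPlaces K) := by rw [← pow_add, hrank]
    _ ≤ (4 * Real.pi * Real.exp Real.eulerMascheroniConstant) ^ nrRealPlaces K *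
          (2 * Real.pi * Real.exp Real.eulerMascheroniConstant) ^ (2 * nrComplexPlaces K) := by
        gcongr
        linarith

/-- **Numeric form, totally real fields**: `|d_K| ≥ 22.38^n · e^{−2√(π²n/2) − 2}` for every totally
real number field `K` of degree `n`. [cite: Bordelles2020ArithmeticTales, Prop. 7.32] -/
theorem absdiscr_ge_numeric_totallyReal (K : Type*) [Field K] [NumberField K] [IsTotallyReal K] :
    (22.38 : ℝ) ^ Module.finrank ℚ K *
        Real.exp (-(2 * Real.sqrt (Real.pi ^ 2 * Module.finrank ℚ K / 2) + 2)) ≤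
      ((discr K).natAbs : ℝ) := by
  have h := absdiscr_ge_signature K
  have h4 := lt_four_pi_exp_eulerMascheroni
  rw [IsTotallyReal.nrComplexPlaces_eq_zero, mul_zero, pow_zero, mul_one,
    ← IsTotallyReal.finrank] at h
  refine le_trans ?_ h
  gcongr

/-! ### Asymptotic root-discriminant bounds -/

/-- Elementary step: for `δ > 0` there is `N` such that `2√(π²n/2) + 2 ≤ δ·n` for all `n ≥ N`.
[folklore] -/
theorem exists_sqrt_error_le {δ : ℝ} (hδ : 0 < δ) :
    ∃ N : ℕ, ∀ n : ℕ, N ≤ n → 2 * Real.sqrt (Real.pi ^ 2 * n / 2) + 2 ≤ δ * n := by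
  -- `2√(π²n/2) + 2 ≤ 2π√n + 2 ≤ (2π + 2)√n ≤ δ n` as soon as `√n ≥ (2π+2)/δ`
  obtain ⟨N, hN⟩ := exists_nat_gt (((2 * Real.pi + 2) / δ) ^ 2 + 1)
  refine ⟨N, fun n hn ↦ ?_⟩
  have hπ0 := Real.pi_pos
  have hn' : ((2 * Real.pi + 2) / δ) ^ 2 + 1 < n := lt_of_lt_of_le hN (by exact_mod_cast hn)
  have hn1 : (1 : ℝ) ≤ n := by
    have : (0 : ℝ) ≤ ((2 * Real.pi + 2) / δ) ^ 2 := sq_nonneg _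
    linarith
  set r : ℝ := Real.sqrt n with hr
  have hr2 : r ^ 2 = n := by rw [hr, Real.sq_sqrt (by linarith)]
  have hr1 : 1 ≤ r := by
    rw [hr]; exact Real.one_le_sqrt.2 hn1
  have hrge : (2 * Real.pi + 2) / δ ≤ r := by
    by_contra hlt
    push Not at hlt
    have h0 : 0 ≤ (2 * Real.pi + 2) / δ := by positivity
    have h1 : 0 < (2 * Real.pi + 2) / δ + r := by linarith
    have h2 := mul_pos (sub_pos.2 hlt) h1
    nlinarith
  have hδr : 2 * Real.pi + 2 ≤ δ * r := by
    have := (div_le_iff₀ hδ).1 hrge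
    linarith
  -- `√(π²n/2) ≤ π r`
  have hsq : Real.sqrt (Real.pi ^ 2 * n / 2) ≤ Real.pi * r := by
    calc Real.sqrt (Real.pi ^ 2 * n / 2) ≤ Real.sqrt ((Real.pi * r) ^ 2) :=
          Real.sqrt_le_sqrt (by rw [mul_pow, hr2]; nlinarith [sq_nonneg Real.pi])
      _ = Real.pi * r := Real.sqrt_sq (by positivity)
  calc 2 * Real.sqrt (Real.pi ^ 2 * n / 2) + 2 ≤ 2 * (Real.pi * r) + 2 * r := by nlinarith
    _ = (2 * Real.pi + 2) * r := by ring
    _ ≤ δ * r * r := by nlinarith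
    _ = δ * n := by rw [← hr2]; ring

/-- **Asymptotic root-discriminant bound** (Stark–Odlyzko constants with the prime and zero sums
discarded): for every `θ < 2πe^γ ≈ 11.19` there is `N` such that `|d_K| ≥ θ^n` for every number
field `K` of degree `n ≥ N`. [cite: Bordelles2020ArithmeticTales, Prop. 7.32] -/
theorem exists_pow_le_absdiscr_of_lt {θ : ℝ} (hθ0 : 0 ≤ θ)
    (hθ : θ < 2 * Real.pi * Real.exp Real.eulerMascheroniConstant) :
    ∃ N : ℕ, ∀ (K : Type) [Field K] [NumberField K], N ≤ Module.finrank ℚ K →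
      θ ^ Module.finrank ℚ K ≤ ((discr K).natAbs : ℝ) := by
  have hπ0 := Real.pi_pos
  rcases hθ0.eq_or_lt with rfl | hθpos
  · refine ⟨1, fun K _ _ hn ↦ ?_⟩
    rw [zero_pow (by omega)]
    exact Nat.cast_nonneg _
  set C : ℝ := 2 * Real.pi * Real.exp Real.eulerMascheroniConstant with hC
  have hC0 : 0 < C := by positivity
  have hδ : 0 < Real.log C - Real.log θ := by
    have := Real.log_lt_log hθpos hθ
    linarith
  obtain ⟨N, hN⟩ := exists_sqrt_error_le hδ
  refine ⟨N, fun K _ _ hn ↦ ?_⟩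
  have h := log_absdiscr_ge_signature K
  have herr := hN _ hn
  have hd : 0 < ((discr K).natAbs : ℝ) := by exact_mod_cast Int.natAbs_pos.mpr (discr_ne_zero K)
  have hrank : (nrRealPlaces K : ℝ) + 2 * nrComplexPlaces K = Module.finrank ℚ K := by
    exact_mod_cast card_add_two_mul_card_eq_rank K
  have hr1 : (0 : ℝ) ≤ nrRealPlaces K := Nat.cast_nonneg _
  have hlogC : Real.log C = Real.log (2 * Real.pi) + Real.eulerMascheroniConstant := by
    rw [hC, Real.log_mul (by positivity) (Real.exp_pos _).ne', Real.log_exp]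
  have h42 : Real.log (2 * Real.pi) ≤ Real.log (4 * Real.pi) :=
    Real.log_le_log (by positivity) (by linarith)
  -- `log|d_K| ≥ n log C − (2√(π²n/2) + 2) ≥ n log C − δ n = n log θ`
  have e1 := mul_le_mul_of_nonneg_left h42 hr1
  have e3 : (Module.finrank ℚ K : ℝ) * Real.log C =
      ((nrRealPlaces K : ℝ) + 2 * nrComplexPlaces K) *
        (Real.log (2 * Real.pi) + Real.eulerMascheroniConstant) := by
    rw [hrank, hlogC]
  have hlog : (Module.finrank ℚ K : ℝ) * Real.log θ ≤ Real.log ((discr K).natAbs : ℝ) := by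
    linarith [h, e1, e3, herr]
  have := Real.exp_le_exp.2 hlog
  rwa [Real.exp_nat_mul, Real.exp_log hθpos, Real.exp_log hd] at this

/-- **Asymptotic root-discriminant bound, totally real fields**: for every `θ < 4πe^γ ≈ 22.38`
there is `N` such that `|d_K| ≥ θ^n` for every totally real number field `K` of degree `n ≥ N`.
[cite: Bordelles2020ArithmeticTales, Prop. 7.32] -/
theorem exists_pow_le_absdiscr_totallyReal_of_lt {θ : ℝ} (hθ0 : 0 ≤ θ)
    (hθ : θ < 4 * Real.pi * Real.exp Real.eulerMascheroniConstant) :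
    ∃ N : ℕ, ∀ (K : Type) [Field K] [NumberField K] [IsTotallyReal K], N ≤ Module.finrank ℚ K →
      θ ^ Module.finrank ℚ K ≤ ((discr K).natAbs : ℝ) := by
  have hπ0 := Real.pi_pos
  rcases hθ0.eq_or_lt with rfl | hθpos
  · refine ⟨1, fun K _ _ _ hn ↦ ?_⟩
    rw [zero_pow (by omega)]
    exact Nat.cast_nonneg _
  set C : ℝ := 4 * Real.pi * Real.exp Real.eulerMascheroniConstant with hC
  have hC0 : 0 < C := by positivity
  have hδ : 0 < Real.log C - Real.log θ := by
    have := Real.log_lt_log hθpos hθ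
    linarith
  obtain ⟨N, hN⟩ := exists_sqrt_error_le hδ
  refine ⟨N, fun K _ _ _ hn ↦ ?_⟩
  have h := log_absdiscr_ge_signature K
  rw [IsTotallyReal.nrComplexPlaces_eq_zero] at h
  have herr := hN _ hn
  have hd : 0 < ((discr K).natAbs : ℝ) := by exact_mod_cast Int.natAbs_pos.mpr (discr_ne_zero K)
  have hrank : (nrRealPlaces K : ℝ) = Module.finrank ℚ K := by
    exact_mod_cast (IsTotallyReal.finrank K).symm
  have hlogC : Real.log C = Real.log (4 * Real.pi) + Real.eulerMascheroniConstant := by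
    rw [hC, Real.log_mul (by positivity) (Real.exp_pos _).ne', Real.log_exp]
  have e3 : (Module.finrank ℚ K : ℝ) * Real.log C =
      (nrRealPlaces K : ℝ) * (Real.log (4 * Real.pi) + Real.eulerMascheroniConstant) := by
    rw [← hrank, hlogC]
  have hlog : (Module.finrank ℚ K : ℝ) * Real.log θ ≤ Real.log ((discr K).natAbs : ℝ) := by
    push_cast at h
    linarith [h, herr, e3]
  have := Real.exp_le_exp.2 hlog
  rwa [Real.exp_nat_mul, Real.exp_log hθpos, Real.exp_log hd] at this

/-! ### The degree is `O(log |d_K|)` -/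

/-- **The degree of a number field is `O(log|d_K|)`**: `n ≤ (log|d_K| + 8)/log 2π` for every number
field `K` (from `|d_K| > e^{−8}(2π)^n`, [Bordelles2020ArithmeticTales, Cor. 7.9]; slope
`1/log 2π ≈ 0.544`, against `1/log(3π/4) ≈ 1.17` from Minkowski's bound `NumberField.abs_discr_ge`).
[cite: Bordelles2020ArithmeticTales, Cor. 7.9] -/
theorem finrank_le_log_absdiscr (K : Type*) [Field K] [NumberField K] :
    (Module.finrank ℚ K : ℝ) ≤ (Real.log ((discr K).natAbs : ℝ) + 8) / Real.log (2 * Real.pi) := by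
  have hπ := Real.pi_gt_three
  have hπ' := Real.pi_lt_d2
  have hlog2π : 0 < Real.log (2 * Real.pi) := Real.log_pos (by linarith)
  have hd1 : (1 : ℝ) ≤ ((discr K).natAbs : ℝ) := by
    exact_mod_cast Int.natAbs_pos.mpr (discr_ne_zero K)
  have hlogd : 0 ≤ Real.log ((discr K).natAbs : ℝ) := Real.log_nonneg hd1
  rw [le_div_iff₀ hlog2π]
  rcases lt_or_ge (Module.finrank ℚ K) 2 with hn | hn
  · -- `n = 1`
    have hn1 : Module.finrank ℚ K = 1 := by
      have := Module.finrank_pos (R := ℚ) (M := K)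
      omega
    have hlog8 : Real.log (2 * Real.pi) ≤ 8 := by
      have := Real.log_le_sub_one_of_pos (show (0 : ℝ) < 2 * Real.pi by positivity)
      linarith
    rw [hn1]
    push_cast
    linarith
  · have h := exp_neg_eight_mul_two_pi_pow_lt_absdiscr K hn
    have h' := Real.log_lt_log (by positivity) h
    rw [Real.log_mul (Real.exp_pos _).ne' (by positivity), Real.log_exp, Real.log_pow] at h'
    linarith

end Discriminant

end Summit.QuantumAdvantage.QuantumAdvantage.Theorems.DegreeOnePrimesEscape

end
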